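import Mathlib
import HarnessLib

/-!
# Venture HSemireg — LEMMA S of the g = 8 family-B census for every n: a SIGNED PURE-WEIL unit-graph design on E_iⁿ × E_iⁿ (all 3ⁿ − 2
# visible moments zero, Weil moment non-zero) has at least 2ⁿ letters in its support — s(n) ≥ 2·s(n−1) by slicing along one factor,
# so 16 ≤ s(4) ≤ 32 with t-20's T32 as the upper witness, and s(1) = 2, s(2) = 4, 8 ≤ s(3) ≤ 16 by the first rungs

HONEST FRAMING. Part of the Lean index of the computation cell `pub-hsemireg` (Sunday typer seat p9, § g = 8; family B row **B20-3** of
`target-g8/CENSUS.md` v1.274 `7744dc4867915f69`: «SIGNED pure-Weil unit-graph cycles: R_re (support 128), m_H (64), T32 (32); ladder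
supports 2 / 4 / 16 at n = 1 / 2 / 3; bounds s(3) ∈ [8,16], s(4) ∈ [16,32]»). FINITE GAUSSIAN-INTEGER ARITHMETIC ONLY: functions
`m : (ℤ∕4)ⁿ → ℤ` (signed designs by exponent vectors), the 3ⁿ characters `x ↦ i^{ε·x}` (`ε ∈ {0,±1}ⁿ`), their moments and a support
count. No abelian variety, graph Γ_D, cycle or class is constructed; the DICTIONARY (t-20 §2.1 LEMMA W in its filler-free form: a signed
unit-graph design is a class-exact PURE-WEIL cycle with ℤ-coefficients iff all its visible moments vanish; W-alive iff m̂(1,…,1) ≠ 0) is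
TEXT OF RECORD, not a binder and not proved here; nothing here says that HC ∕ HC_CM ∕ HC_AV holds; no object is certified (row B20-3:
«class witnesses, not objects»); no Literature fact is declared.

TEXT OF RECORD (quoted, not interpreted). Source: t-20, `target-g8/FAMILY-B-G8-t20.md` v1.25 `987a3ee140325c40`, §2.6: «LEMMA S:
s(1) = 2, s(2) = 4; s(n) ≥ 2 s(n−1) (slice along one factor: off the top frequency only the invisible character (−1)^{x_k} survives in
the partial transform, so the SUM of two adjacent slices x_k = a, a+1 is a pure (n−1)-design; summing over the four adjacent pairs gives
the bound); hence 8 ≤ s(3) ≤ 16, 16 ≤ s(4) ≤ 32.» (s(n) = the minimal support of a filler-free signed pure-Weil W-alive unit-graph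
design on E_iⁿ × E_iⁿ.)

WHAT THIS FILE PROVES (every n; `Letter n = Fin n → Fin 4`, `Eps n = Fin n → Fin 3` with the code 0 ↦ ε_k = 0, 1 ↦ +1, 2 ↦ −1;
`unitTab` = (1, i, −1, −i), `expo ε x = ε·x ∈ ℤ∕4`, `vchi ε x = i^{ε·x}`, `vmoment m ε = m̂(ε)`, `plus`∕`minus` the two invisible
patterns; PURE = «m̂(ε) = 0 for every ε ∉ {plus, minus}», carried as an explicit hypothesis). §1 the SLICING along factor 0: `sl m a`
(x' ↦ m(a, x') + m(a+1, x')), the slice moments `G m ε' b`, `vmoment_cons` (m̂(t, ε') = Σ_b i^{c_t b}·G(b) — the partial transform),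
`vmoment_sl` (the slice-pair design has moments G(a) + G(a+1)), and the FOUR-POINT IDENTITY `four_mul_pair`
(4·(G(a) + G(a+1)) = 2·m̂(0,ε') + (1−i)i^{−a}·m̂(+,ε') + (1+i)i^{a}·m̂(−,ε') — «only the invisible character (−1)^{x_k} survives, and
it cancels on adjacent slices»). §2 **`sl_pure`** (m pure ⇒ every slice-pair design pure) and **`sl_alive`** (n ≥ 1, m pure and W-alive
⇒ every slice-pair design W-alive: 4·m̂_{a}(+,…,+) = (1−i)i^{−a}·m̂(+,…,+) ≠ 0). §3 the count: `card_supp_sl_le` (#supp(sl m a) ≤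
#slice_a + #slice_{a+1}), `sum_card_slices` (Σ_a #slice_a = #supp m), the base case `two_le_card_support_one` (s(1) ≥ 2) and
**`two_pow_le_card_support_pure`** = LEMMA S iterated: for every n ≥ 1, a pure W-alive signed design on (ℤ∕4)ⁿ has ≥ 2ⁿ support
letters; `sixteen_le_card_support_pure` is the census instance n = 4 («16 ≤ s(4)»), `eight_le_card_support_pure` the instance n = 3
(«8 ≤ s(3)»).

§4 the first four RUNGS of the signed ladder as kernel `decide` certificates (`rung1`, `rung2`, `rung3` with supports 2 ∕ 4 ∕ 16, pure and
W-alive: `rungs_certificate`; `rung4` = t-20's T32, support 32: `rung4_certificate`) — so s(1) = 2 and s(2) = 4 exactly, 8 ≤ s(3) ≤ 16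
and 16 ≤ s(4) ≤ 32, all in the kernel and in one vocabulary (R_re, m_H and T32's Hamming histogram are in `SignedPureWeilDesignsN4.lean`).

WHAT IS NOT HERE. The exact values of s(3), s(4); LEMMA W; anything about sheaves, fillers or semiregularity.
-/

namespace Summit.Ventures.HSemireg.SignedWeilDesignN

open Finset

variable {n : ℕ}

/-- Exponent vectors `x ∈ (ℤ∕4)ⁿ`: the letter of factor `k` is `i^{x_k}`. [definition of this file] -/
abbrev Letter (n : ℕ) := Fin n → Fin 4

/-- Moment patterns `ε ∈ {0, ±1}ⁿ`, coded `0 ↦ 0`, `1 ↦ +1`, `2 ↦ −1`. [definition of this file] -/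
abbrev Eps (n : ℕ) := Fin n → Fin 3

/-- The table of fourth roots of unity `(1, i, −1, −i)` in `ℤ[i]`. [definition of this file] -/
def unitTab : Fin 4 → GaussianInt := ![1, ⟨0, 1⟩, -1, -⟨0, 1⟩]

/-- The coefficient `ε_k ∈ ℤ∕4` of a pattern code: `0 ↦ 0`, `+1 ↦ 1`, `−1 ↦ 3`. [definition of this file] -/
def coef : Fin 3 → Fin 4 := ![0, 1, 3]

/-- The exponent `ε·x ∈ ℤ∕4`. [definition of this file] -/
def expo (ε : Eps n) (x : Letter n) : Fin 4 := ∑ k, coef (ε k) * x k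

/-- The character value `i^{ε·x}`. [definition of this file] -/
def vchi (ε : Eps n) (x : Letter n) : GaussianInt := unitTab (expo ε x)

/-- The moment `m̂(ε) = Σ_x m(x)·i^{ε·x}` of an integer (signed) design. [definition of this file] -/
def vmoment (m : Letter n → ℤ) (ε : Eps n) : GaussianInt := ∑ x, (m x : GaussianInt) * vchi ε x

/-- The all-plus pattern (the Weil moment, coefficient of Ω). [definition of this file] -/
def plus : Eps n := fun _ => 1

/-- The all-minus pattern (coefficient of Ω̄). [definition of this file] -/
def minus : Eps n := fun _ => 2

/-- The support of a design. [definition of this file] -/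
def supp (m : Letter n → ℤ) : Finset (Letter n) := Finset.univ.filter (fun x => m x ≠ 0)

/-- `i^{u+v} = i^u·i^v` on the table. -/
theorem unitTab_add : ∀ u v : Fin 4, unitTab (u + v) = unitTab u * unitTab v := by decide

/-- The table values are non-zero. -/
theorem unitTab_ne_zero : ∀ u : Fin 4, unitTab u ≠ 0 := by decide

/-! ## §1 Slicing along factor 0 -/

/-- The SLICE-PAIR design on the remaining factors: `x' ↦ m(a, x') + m(a+1, x')` («the SUM of two adjacent slices x_k = a, a+1»).
[definition of this file] -/
def sl (m : Letter (n + 1) → ℤ) (a : Fin 4) : Letter n → ℤ := fun x' => m (Fin.cons a x') + m (Fin.cons (a + 1) x')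

/-- The slice moments `G(b) = Σ_{x'} m(b, x')·i^{ε'·x'}` (the partial transform in the remaining factors). [definition of this file] -/
def G (m : Letter (n + 1) → ℤ) (ε' : Eps n) (b : Fin 4) : GaussianInt := ∑ x' : Letter n, (m (Fin.cons b x') : GaussianInt) * vchi ε' x'

/-- Summing over (ℤ∕4)^{n+1} = summing over the first letter and the rest. -/
theorem sum_letter_succ {R : Type*} [AddCommMonoid R] (f : Letter (n + 1) → R) :
    (∑ x, f x) = ∑ b : Fin 4, ∑ x' : Letter n, f (Fin.cons b x') := by
  rw [← Equiv.sum_comp (Fin.consEquiv (fun _ : Fin (n + 1) => Fin 4)) f, Fintype.sum_prod_type]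
  rfl

/-- The exponent splits: `(t, ε')·(b, x') = c_t·b + ε'·x'`. -/
theorem expo_cons (t : Fin 3) (ε' : Eps n) (b : Fin 4) (x' : Letter n) :
    expo (Fin.cons t ε' : Eps (n + 1)) (Fin.cons b x') = coef t * b + expo ε' x' := by
  simp only [expo]
  rw [Fin.sum_univ_succ]
  simp only [Fin.cons_zero, Fin.cons_succ]

/-- **THE PARTIAL TRANSFORM:** `m̂(t, ε') = Σ_b i^{c_t·b}·G(b)`. -/
theorem vmoment_cons (m : Letter (n + 1) → ℤ) (t : Fin 3) (ε' : Eps n) :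
    vmoment m (Fin.cons t ε') = ∑ b : Fin 4, unitTab (coef t * b) * G m ε' b := by
  unfold vmoment
  rw [sum_letter_succ]
  refine Finset.sum_congr rfl (fun b _ => ?_)
  rw [G, Finset.mul_sum]
  refine Finset.sum_congr rfl (fun x' _ => ?_)
  rw [vchi, expo_cons, unitTab_add, vchi]
  ring

/-- The moments of the slice-pair design: `m̂_{sl a}(ε') = G(a) + G(a+1)`. -/
theorem vmoment_sl (m : Letter (n + 1) → ℤ) (a : Fin 4) (ε' : Eps n) :
    vmoment (sl m a) ε' = G m ε' a + G m ε' (a + 1) := by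
  simp only [vmoment, sl, G, ← Finset.sum_add_distrib]
  refine Finset.sum_congr rfl (fun x' _ => ?_)
  push_cast
  ring

/-- The unit `(1 − i)·i^{−a}`, tabulated. [definition of this file] -/
def uTab : Fin 4 → GaussianInt := ![⟨1, -1⟩, ⟨-1, -1⟩, ⟨-1, 1⟩, ⟨1, 1⟩]

/-- The unit `(1 + i)·i^{a}`, tabulated. [definition of this file] -/
def vTab : Fin 4 → GaussianInt := ![⟨1, 1⟩, ⟨-1, 1⟩, ⟨-1, -1⟩, ⟨1, -1⟩]

/-- `uTab a ≠ 0`. -/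
theorem uTab_ne_zero : ∀ a : Fin 4, uTab a ≠ 0 := by decide

/-- **THE FOUR-POINT IDENTITY** («off the top frequency only the invisible character (−1)^{x_k} survives in the partial transform» —
and it cancels on two ADJACENT slices): `4·(G(a) + G(a+1)) = 2·m̂(0,ε') + (1−i)i^{−a}·m̂(+,ε') + (1+i)i^{a}·m̂(−,ε')`. -/
theorem four_mul_pair (m : Letter (n + 1) → ℤ) (ε' : Eps n) (a : Fin 4) :
    4 * (G m ε' a + G m ε' (a + 1)) =
      2 * vmoment m (Fin.cons 0 ε') + uTab a * vmoment m (Fin.cons 1 ε') + vTab a * vmoment m (Fin.cons 2 ε') := by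
  rw [vmoment_cons, vmoment_cons, vmoment_cons]
  simp only [Fin.sum_univ_four]
  fin_cases a <;> simp [unitTab, uTab, vTab, coef] <;> (ext <;> simp <;> ring)

/-! ## §2 The slice-pair designs are pure and W-alive -/

/-- A pattern with a visible tail is visible. -/
theorem cons_ne_plus_of_ne (t : Fin 3) (ε' : Eps n) (h : ε' ≠ plus) : (Fin.cons t ε' : Eps (n + 1)) ≠ plus := by
  intro hc
  apply h
  funext k
  have := congrFun hc k.succ
  simpa [plus] using this

/-- A pattern with a visible tail is visible (minus version). -/
theorem cons_ne_minus_of_ne (t : Fin 3) (ε' : Eps n) (h : ε' ≠ minus) : (Fin.cons t ε' : Eps (n + 1)) ≠ minus := by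
  intro hc
  apply h
  funext k
  have := congrFun hc k.succ
  simpa [minus] using this

/-- **SLICES OF A PURE DESIGN ARE PURE:** if all visible moments of `m` vanish, so do all visible moments of every slice-pair design
`sl m a` («the SUM of two adjacent slices … is a pure (n−1)-design»). -/
theorem sl_pure (m : Letter (n + 1) → ℤ)
    (hpure : ∀ ε : Eps (n + 1), ε ≠ plus → ε ≠ minus → vmoment m ε = 0) (a : Fin 4) :
    ∀ ε' : Eps n, ε' ≠ plus → ε' ≠ minus → vmoment (sl m a) ε' = 0 := by
  intro ε' hp hm
  have h4 := four_mul_pair m ε' a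
  rw [hpure _ (cons_ne_plus_of_ne 0 ε' hp) (cons_ne_minus_of_ne 0 ε' hm),
    hpure _ (cons_ne_plus_of_ne 1 ε' hp) (cons_ne_minus_of_ne 1 ε' hm),
    hpure _ (cons_ne_plus_of_ne 2 ε' hp) (cons_ne_minus_of_ne 2 ε' hm)] at h4
  simp only [mul_zero, add_zero] at h4
  rw [vmoment_sl]
  rcases mul_eq_zero.mp h4 with h | h
  · exact absurd h (by norm_num)
  · exact h

/-- `(+, +, …, +)` with a plus prepended is all-plus. -/
theorem cons_one_plus : (Fin.cons 1 (plus : Eps n) : Eps (n + 1)) = plus := by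
  funext k
  refine Fin.cases ?_ (fun i => ?_) k
  · simp [plus]
  · simp [plus]

/-- **SLICES OF A PURE W-ALIVE DESIGN ARE W-ALIVE** (n ≥ 1, so that the patterns (0,+,…,+) and (−,+,…,+) are visible):
`4·m̂_{sl a}(+,…,+) = (1−i)i^{−a}·m̂(+,…,+) ≠ 0`. -/
theorem sl_alive (hn : 0 < n) (m : Letter (n + 1) → ℤ)
    (hpure : ∀ ε : Eps (n + 1), ε ≠ plus → ε ≠ minus → vmoment m ε = 0) (halive : vmoment m plus ≠ 0) (a : Fin 4) :
    vmoment (sl m a) plus ≠ 0 := by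
  have h4 := four_mul_pair m plus a
  -- (0,+,…,+) and (−,+,…,+) are visible
  have h0p : (Fin.cons 0 (plus : Eps n) : Eps (n + 1)) ≠ plus := by
    intro hc; have := congrFun hc 0; simp [plus] at this
  have h0m : (Fin.cons 0 (plus : Eps n) : Eps (n + 1)) ≠ minus := by
    intro hc; have := congrFun hc 0; simp [minus] at this
  have h2p : (Fin.cons 2 (plus : Eps n) : Eps (n + 1)) ≠ plus := by
    intro hc; have := congrFun hc 0; simp [plus] at this
  have h2m : (Fin.cons 2 (plus : Eps n) : Eps (n + 1)) ≠ minus := by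
    intro hc
    have := congrFun hc (Fin.succ ⟨0, hn⟩)
    rw [Fin.cons_succ] at this
    simp [plus, minus] at this
  rw [hpure _ h0p h0m, hpure _ h2p h2m, cons_one_plus, mul_zero, mul_zero, zero_add, add_zero] at h4
  intro hzero
  rw [vmoment_sl] at hzero
  rw [hzero, mul_zero] at h4
  rcases mul_eq_zero.mp h4.symm with h | h
  · exact uTab_ne_zero a h
  · exact halive h

/-! ## §3 Counting: s(n+1) ≥ 2·s(n), hence s(n) ≥ 2ⁿ -/

/-- The slice of the support over the first letter `b`, as a set of tails. [definition of this file] -/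
def sliceSupp (m : Letter (n + 1) → ℤ) (b : Fin 4) : Finset (Letter n) := Finset.univ.filter (fun x' => m (Fin.cons b x') ≠ 0)

/-- The support of a slice-pair design lies in the union of the two slices. -/
theorem card_supp_sl_le (m : Letter (n + 1) → ℤ) (a : Fin 4) :
    (supp (sl m a)).card ≤ (sliceSupp m a).card + (sliceSupp m (a + 1)).card := by
  refine le_trans (Finset.card_le_card ?_) (Finset.card_union_le _ _)
  intro x' hx
  have hx' : sl m a x' ≠ 0 := (Finset.mem_filter.mp hx).2
  rw [Finset.mem_union]
  by_cases h1 : m (Fin.cons a x') = 0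
  · right
    refine Finset.mem_filter.mpr ⟨Finset.mem_univ _, ?_⟩
    intro h2
    apply hx'
    simp [sl, h1, h2]
  · left
    exact Finset.mem_filter.mpr ⟨Finset.mem_univ _, h1⟩

/-- The slices partition the support: `Σ_b #slice_b = #supp m`. -/
theorem sum_card_slices (m : Letter (n + 1) → ℤ) : (∑ b : Fin 4, (sliceSupp m b).card) = (supp m).card := by
  rw [Finset.card_eq_sum_card_fiberwise (f := fun x : Letter (n + 1) => x 0) (t := Finset.univ) (fun _ _ => Finset.mem_univ _)]
  refine Finset.sum_congr rfl (fun b _ => ?_)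
  -- the fibre over b is in bijection with the slice via Fin.cons b
  refine Finset.card_bij' (fun x' _ => Fin.cons b x') (fun x _ => Fin.tail x) ?_ ?_ ?_ ?_
  · intro x' hx'
    have h := (Finset.mem_filter.mp hx').2
    exact Finset.mem_filter.mpr ⟨Finset.mem_filter.mpr ⟨Finset.mem_univ _, h⟩, by simp⟩
  · intro x hx
    obtain ⟨hxs, hx0⟩ := Finset.mem_filter.mp hx
    have hm := (Finset.mem_filter.mp hxs).2
    refine Finset.mem_filter.mpr ⟨Finset.mem_univ _, ?_⟩
    have : Fin.cons b (Fin.tail x) = x := by rw [← hx0]; exact Fin.cons_self_tail x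
    rw [this]
    exact hm
  · intro x' _
    exact Fin.tail_cons _ _
  · intro x hx
    obtain ⟨_, hx0⟩ := Finset.mem_filter.mp hx
    rw [← hx0]
    exact Fin.cons_self_tail x

/-- Shifting the first letter by one permutes the slices: `Σ_a #slice_{a+1} = Σ_a #slice_a`. -/
theorem sum_card_slices_shift (m : Letter (n + 1) → ℤ) :
    (∑ a : Fin 4, (sliceSupp m (a + 1)).card) = ∑ a : Fin 4, (sliceSupp m a).card :=
  Equiv.sum_comp (Equiv.addRight (1 : Fin 4)) (fun b => (sliceSupp m b).card)

/-- **THE BASE CASE s(1) ≥ 2:** a signed design on ℤ∕4 with `m̂(0) = Σ m = 0` and `m̂(+) ≠ 0` has at least two support letters. -/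
theorem two_le_card_support_one (m : Letter 1 → ℤ)
    (hpure : ∀ ε : Eps 1, ε ≠ plus → ε ≠ minus → vmoment m ε = 0) (halive : vmoment m plus ≠ 0) :
    2 ≤ (supp m).card := by
  -- the zero pattern is visible: Σ_x m x = 0
  have hz : vmoment m (fun _ => 0) = 0 := by
    refine hpure _ ?_ ?_
    · intro h; have := congrFun h 0; simp [plus] at this
    · intro h; have := congrFun h 0; simp [minus] at this
  have hsum : (∑ x : Letter 1, (m x : GaussianInt)) = 0 := by
    rw [← hz]
    unfold vmoment vchi expo
    refine Finset.sum_congr rfl (fun x _ => ?_)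
    simp [coef, unitTab]
  -- some letter carries support
  obtain ⟨x₀, _, hx₀⟩ := Finset.exists_ne_zero_of_sum_ne_zero halive
  have hm₀ : m x₀ ≠ 0 := by
    intro h0; apply hx₀; rw [h0]; simp
  by_contra hlt
  have hle : (supp m).card ≤ 1 := by omega
  -- then the support is {x₀} and Σ m = m x₀ ≠ 0
  have hsingle : ∀ x, m x ≠ 0 → x = x₀ := by
    intro x hx
    exact Finset.card_le_one.mp hle x (Finset.mem_filter.mpr ⟨Finset.mem_univ _, hx⟩) x₀
      (Finset.mem_filter.mpr ⟨Finset.mem_univ _, hm₀⟩)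
  have : (∑ x : Letter 1, (m x : GaussianInt)) = m x₀ := by
    rw [Finset.sum_eq_single x₀]
    · intro x _ hx
      by_cases h : m x = 0
      · simp [h]
      · exact absurd (hsingle x h) hx
    · intro h; exact absurd (Finset.mem_univ _) h
  rw [this] at hsum
  exact hm₀ (by exact_mod_cast hsum)

/-- **LEMMA S, ITERATED: s(n) ≥ 2ⁿ for every n ≥ 1.** A signed design on (ℤ∕4)ⁿ all of whose 3ⁿ − 2 visible moments vanish (pure
Weil, filler-free) and whose Weil moment `m̂(+,…,+)` is non-zero has at least `2ⁿ` letters in its support. Induction on n: the four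
slice-pair designs along factor 0 are pure and W-alive (`sl_pure`, `sl_alive`), each has ≥ 2^{n−1} support letters, and
`2·#supp m = Σ_a (#slice_a + #slice_{a+1}) ≥ 4·2^{n−1}`. -/
theorem two_pow_le_card_support_pure : ∀ (n : ℕ), 0 < n → ∀ (m : Letter n → ℤ),
    (∀ ε : Eps n, ε ≠ plus → ε ≠ minus → vmoment m ε = 0) → vmoment m plus ≠ 0 → 2 ^ n ≤ (supp m).card := by
  intro n hn
  induction n with
  | zero => exact absurd hn (lt_irrefl 0)
  | succ k ih =>
    intro m hpure halive
    rcases Nat.eq_zero_or_pos k with hk | hk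
    · subst hk
      simpa using two_le_card_support_one m hpure halive
    · -- every slice-pair design is pure and alive, hence has ≥ 2^k support letters
      have hsl : ∀ a : Fin 4, 2 ^ k ≤ (supp (sl m a)).card :=
        fun a => ih hk (sl m a) (sl_pure m hpure a) (sl_alive hk m hpure halive a)
      have hsum : 4 * 2 ^ k ≤ ∑ a : Fin 4, (supp (sl m a)).card := by
        calc 4 * 2 ^ k = ∑ _a : Fin 4, 2 ^ k := by simp
          _ ≤ ∑ a : Fin 4, (supp (sl m a)).card := Finset.sum_le_sum (fun a _ => hsl a)
      have hle : (∑ a : Fin 4, (supp (sl m a)).card) ≤ 2 * (supp m).card := by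
        calc (∑ a : Fin 4, (supp (sl m a)).card)
            ≤ ∑ a : Fin 4, ((sliceSupp m a).card + (sliceSupp m (a + 1)).card) :=
              Finset.sum_le_sum (fun a _ => card_supp_sl_le m a)
          _ = (∑ a : Fin 4, (sliceSupp m a).card) + ∑ a : Fin 4, (sliceSupp m (a + 1)).card := Finset.sum_add_distrib
          _ = 2 * (supp m).card := by rw [sum_card_slices_shift, sum_card_slices]; ring
      have : 2 ^ (k + 1) = 2 * 2 ^ k := by ring
      omega

/-- **THE CENSUS INSTANCE n = 4: 16 ≤ s(4).** A filler-free signed pure-Weil W-alive unit-graph design on E_i⁴ × E_i⁴ has at least 16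
letters (row B20-3 «s(4) ∈ [16,32]»; the upper bound is the kernel witness T32 of `SignedPureWeilDesignsN4.lean`). -/
theorem sixteen_le_card_support_pure (m : Letter 4 → ℤ)
    (hpure : ∀ ε : Eps 4, ε ≠ plus → ε ≠ minus → vmoment m ε = 0) (halive : vmoment m plus ≠ 0) :
    16 ≤ (supp m).card := by
  have := two_pow_le_card_support_pure 4 (by norm_num) m hpure halive
  norm_num at this
  exact this

/-- And n = 3: 8 ≤ s(3) (row B20-3 «s(3) ∈ [8,16]»). -/
theorem eight_le_card_support_pure (m : Letter 3 → ℤ)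
    (hpure : ∀ ε : Eps 3, ε ≠ plus → ε ≠ minus → vmoment m ε = 0) (halive : vmoment m plus ≠ 0) :
    8 ≤ (supp m).card := by
  have := two_pow_le_card_support_pure 3 (by norm_num) m hpure halive
  norm_num at this
  exact this

/-! ## §4 The first three rungs of the signed ladder (kernel `decide`) -/

/-- Rung n = 1: `{+Γ_1, −Γ_i}`, i.e. `m(0) = 1`, `m(1) = −1` (support 2). [definition of this file] -/
def rung1 : Letter 1 → ℤ := fun x => if x 0 = 0 then 1 else if x 0 = 1 then -1 else 0

/-- Rung n = 2: `Σ_d (−1)^d Γ_{(i^d, i^d)}`, i.e. `m(d, d) = (−1)^d` (support 4). [definition of this file] -/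
def rung2 : Letter 2 → ℤ := fun x => if x 0 = x 1 then (if x 0 = 0 ∨ x 0 = 2 then 1 else -1) else 0

/-- Rung n = 3 by the tensor trick: `rung1 ⊗ rung2 + (shift 1 rung1) ⊗ (shift (3,0) rung2)`, i.e.
`m(a, d₁, d₂) = rung1(a)·[d₁ = d₂](−1)^{d₁} + rung1(a − 1)·[d₁ = d₂ + 3](−1)^{d₂}` (support 16). [definition of this file] -/
def rung3 : Letter 3 → ℤ := fun x =>
  (if x 0 = 0 then 1 else if x 0 = 1 then -1 else 0) * (if x 1 = x 2 then (if x 1 = 0 ∨ x 1 = 2 then 1 else -1) else 0) +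
  (if x 0 = 1 then 1 else if x 0 = 2 then -1 else 0) * (if x 1 = x 2 + 3 then (if x 2 = 0 ∨ x 2 = 2 then 1 else -1) else 0)

/-- Rung n = 4: t-20's tensor design T32 = `m₂ ⊗ m₂ + (shift (+1,0) m₂) ⊗ (shift (−1,0) m₂)` (§2.6; support 32) — the same function as
`SignedWeilDesign.T32` of `SignedPureWeilDesignsN4.lean`, re-typed in this file's n-parametric vocabulary. [definition of this file] -/
def rung4 : Letter 4 → ℤ := fun x =>
  (if x 0 = x 1 ∧ x 2 = x 3 then (if x 0 = 0 ∨ x 0 = 2 then 1 else -1) * (if x 2 = 0 ∨ x 2 = 2 then 1 else -1) else 0) +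
  (if x 0 = x 1 + 1 ∧ x 2 + 1 = x 3 then (if x 1 = 0 ∨ x 1 = 2 then 1 else -1) * (if x 3 = 0 ∨ x 3 = 2 then 1 else -1) else 0)

/-- **RUNG 4 (T32) IS PURE, W-ALIVE, SUPPORT 32** — so `16 ≤ s(4) ≤ 32` holds with both halves in this file
(`sixteen_le_card_support_pure` and this witness). Kernel `decide` (79 patterns × 256 letters). -/
theorem rung4_certificate :
    (∀ ε : Eps 4, ε ≠ plus → ε ≠ minus → vmoment rung4 ε = 0) ∧ vmoment rung4 plus = 32 ∧ (supp rung4).card = 32 := by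
  refine ⟨?_, by decide +kernel, by decide +kernel⟩
  decide +kernel

/-- **THE RUNGS ARE PURE, W-ALIVE AND HAVE SUPPORTS 2 ∕ 4 ∕ 16** («ladder supports 2 / 4 / 16 at n = 1 / 2 / 3»): with
`two_pow_le_card_support_pure` this gives s(1) = 2 and s(2) = 4 exactly, and 8 ≤ s(3) ≤ 16. Kernel `decide`. -/
theorem rungs_certificate :
    ((∀ ε : Eps 1, ε ≠ plus → ε ≠ minus → vmoment rung1 ε = 0) ∧ vmoment rung1 plus ≠ 0 ∧ (supp rung1).card = 2) ∧
    ((∀ ε : Eps 2, ε ≠ plus → ε ≠ minus → vmoment rung2 ε = 0) ∧ vmoment rung2 plus ≠ 0 ∧ (supp rung2).card = 4) ∧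
    ((∀ ε : Eps 3, ε ≠ plus → ε ≠ minus → vmoment rung3 ε = 0) ∧ vmoment rung3 plus ≠ 0 ∧ (supp rung3).card = 16) := by
  refine ⟨⟨?_, by decide +kernel, by decide +kernel⟩, ⟨?_, by decide +kernel, by decide +kernel⟩,
    ⟨?_, by decide +kernel, by decide +kernel⟩⟩
  · decide +kernel
  · decide +kernel
  · decide +kernel

end Summit.Ventures.HSemireg.SignedWeilDesignN
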